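import Summits.Ventures.QEC.Census.CSSNormalFormSAT.BridgeZ
import HarnessLib

/-!
# Bridge, `(X)` side: from the 𝔽₂ condition `(X)` of the normal form to the counting condition `XCond` (KERNEL-PLAN item 3a)

For `A : Matrix (Fin b) (Fin m) (ZMod 2)` and `s = 1^w 0^{m−w}` (`sVec`), condition `(X)` — `∀ u, ⟨u, s⟩ = 1 → d ≤ wt u + wt (A *ᵥ u)` —
implies `XCond c (boolOf c A)`: apply `(X)` to the indicator vector of each listed column set `U` (these have `|U ∩ [0,w)|` odd, i.e.
`⟨1_U, s⟩ = 1`) and count. [folklore]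
-/

set_option autoImplicit false

namespace Summit.Ventures.QEC.Census.CSSNormalFormSAT

open NFEnc Matrix

/-- The `i`-th entry of `A *ᵥ indVec U` is the indicator sum over `U` (for `U` without duplicates, entries `< m`). [folklore] -/
theorem mulVec_indVec (c : Cfg) (A : Matrix (Fin c.b) (Fin c.m) (ZMod 2)) (I : Fin c.b) :
    ∀ U : List ℕ, U.Nodup → (∀ j ∈ U, j < c.m) →
      (A *ᵥ indVec c.m U) I = (U.map fun j => if boolOf c A I.val j then (1 : ZMod 2) else 0).sum
  | [], _, _ => by
    have : indVec c.m [] = 0 := by funext i; simp [indVec]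
    simp [this]
  | a :: U, hnd, hlt => by
    have ha : a ∉ U := (List.nodup_cons.1 hnd).1
    have ham : a < c.m := hlt a List.mem_cons_self
    rw [indVec_cons a U ha ham, mulVec_add, Pi.add_apply,
      mulVec_indVec c A I U (List.nodup_cons.1 hnd).2 (fun j hj => hlt j (List.mem_cons_of_mem _ hj)),
      List.map_cons, List.sum_cons, add_comm]
    congr 1
    rw [Matrix.mulVec_single_one]
    have hbool : boolOf c A I.val a = decide (A I ⟨a, ham⟩ = 1) := by
      simp [boolOf, ham, I.isLt]
    rw [hbool]
    by_cases h1 : A I ⟨a, ham⟩ = 1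
    · simp [Matrix.col, h1]
    · have z2 : ∀ x : ZMod 2, x ≠ 0 → x = 1 := by decide
      have h0 : A I ⟨a, ham⟩ = 0 := by
        by_contra h; exact h1 (z2 _ h)
      simp [Matrix.col, h0]

/-- `⟨1_U, s⟩` is the parity of `|U ∩ [0,w)|`. [folklore] -/
theorem indVec_dotProduct_sVec (c : Cfg) :
    ∀ U : List ℕ, U.Nodup → (∀ j ∈ U, j < c.m) →
      indVec c.m U ⬝ᵥ sVec c = if (U.filter (· < c.w)).length % 2 == 1 then 1 else 0
  | [], _, _ => by
    have : indVec c.m [] = 0 := by funext i; simp [indVec]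
    simp [this]
  | a :: U, hnd, hlt => by
    have ha : a ∉ U := (List.nodup_cons.1 hnd).1
    have ham : a < c.m := hlt a List.mem_cons_self
    rw [indVec_cons a U ha ham, add_dotProduct,
      indVec_dotProduct_sVec c U (List.nodup_cons.1 hnd).2 (fun j hj => hlt j (List.mem_cons_of_mem _ hj)),
      single_one_dotProduct, List.filter_cons]
    simp only [sVec]
    by_cases haw : a < c.w
    · simp only [haw, decide_true, ↓reduceIte, List.length_cons]
      have hmod : ∀ n : ℕ, ((n + 1) % 2 == 1) = !(n % 2 == 1) := by
        intro n; rcases Nat.mod_two_eq_zero_or_one n with h | h <;> simp [Nat.add_mod, h]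
      rw [hmod]
      cases ((U.filter (· < c.w)).length % 2 == 1) <;> decide
    · simp [haw]

/-- **Bridge, `(X)` side.** [folklore] -/
theorem XCond_of_X (c : Cfg) (A : Matrix (Fin c.b) (Fin c.m) (ZMod 2))
    (hX : ∀ u : Fin c.m → ZMod 2, u ⬝ᵥ sVec c = 1 → c.d ≤ hammingNorm u + hammingNorm (A *ᵥ u)) :
    XCond c (boolOf c A) := by
  intro U hU
  have hU' := hU
  simp only [colSets, List.mem_flatMap, List.mem_filter] at hU'
  obtain ⟨t, -, ht, hodd⟩ := hU'
  obtain ⟨-, hnd, hlt⟩ := combos_spec c.m (t + 1) U ht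
  have hdot : indVec c.m U ⬝ᵥ sVec c = 1 := by
    rw [indVec_dotProduct_sVec c U hnd hlt, if_pos hodd]
  have h := hX (indVec c.m U) hdot
  rw [hammingNorm_indVec c.m U hnd hlt] at h
  have hcount : hammingNorm (A *ᵥ indVec c.m U) =
      ((Finset.range c.b).filter fun i => xvalOf (boolOf c A) U i = true).card := by
    rw [hammingNorm]
    have hset : (Finset.univ.filter fun I : Fin c.b => (A *ᵥ indVec c.m U) I ≠ 0) =
        ((Finset.range c.b).filter fun i => xvalOf (boolOf c A) U i = true).attachFin
          (fun i hi => Finset.mem_range.1 (Finset.mem_filter.1 hi).1) := by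
      ext I
      simp only [Finset.mem_filter, Finset.mem_univ, true_and, Finset.mem_attachFin, Finset.mem_range, I.isLt]
      have z2 : ∀ x : ZMod 2, x ≠ 0 ↔ x = 1 := by decide
      rw [mulVec_indVec c A I U hnd hlt, sum_map_ite_eq_parity, z2, xvalOf]
      cases parity (U.map fun j => boolOf c A I.val j) <;> simp
    rw [hset, Finset.card_attachFin]
  rw [hcount] at h
  exact h

end Summit.Ventures.QEC.Census.CSSNormalFormSAT
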